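import Summits.QuantumFields.YangMills.Theorems.LuscherReductionRunningReductionKTDefs
import Summits.QuantumFields.YangMills.Theorems.FemtoTransferGapSlabRayleigh
import HarnessLib

/-!
# Crux RED `RunningReduction`, line «KT»: the registered stub `stub_ritzBasics` (Rayleigh–Ritz vs. min–max at fixed lattice)

Support module for crux `RunningReduction` (route `LuscherReduction`, item stmt-QuantumFields-19978), line «KT» (owner ym-beyond-p1 g16,
`Lines-KT.lean` abb17db2d52c586d): **`ritzBasics`** is the text of the registered stub `Stmt.stub_ritzBasics = RitzBasics` VERBATIM, stated
over the tree constants `qform2`∕`ritzValue` of `Theorems/LuscherReductionRunningReductionKTDefs.lean` (the skeleton's own copies of the two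
`def`s are character-identical; once the skeleton imports the Theorems defs the stub closes by `exact ritzBasics`).  Fleet service by seat
ym-infvol-p2.  Fixed-lattice linear algebra, kernel-checked:

For a physical family `φ : Fin n → _` with `l2` definite on its span `W`:
* §1 `isPhys_of_mem_span` (spans of physical test functions are physical); the Rayleigh sets inside `W` are bounded by `λ₀` and consist
  of non-negative numbers (`qform_su2Rep_self_nonneg`, `β ≥ 0`), hence `0 ≤ ritzValue β φ j` (clause 3) and `⟨ψ,Kψ⟩ ≤ m₀‖ψ‖²` on `W`
  (clause 2);
* §2 **Riesz representatives inside the span**: `l2` restricted to `W` is a nondegenerate bilinear form on a finite-dimensional space, so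
  every constraint functional `ψ ↦ ⟨ψ, φs_i⟩` (`φs_i` physical, possibly outside `W`) is `⟨ψ, χ_i⟩` for a unique `χ_i ∈ W`
  (Mathlib `LinearMap.BilinForm.toDual`); therefore the `χ`-constrained Rayleigh set of `W` sits inside the `φs`-constrained Rayleigh set of
  all physical test functions, and `ritzValue β φ j ≤ levelValue su2Rep L β j` (clause 1: Rayleigh–Ritz ≤ min–max).

HONEST FRAMING: femto-universe rung R2b1, fixed-lattice functional analysis only; the line's weight is in its two XL stubs; nothing here
bears on infinite volume or the Clay gap.  References: M. Reed, B. Simon IV (1978) Thm XIII.1–2; B. N. Parlett (1998) chs. 10–11.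
-/

set_option autoImplicit false

noncomputable section

open MeasureTheory Filter Topology Real
open Literature.MathematicalPhysics.QuantumFieldTheory
open Literature.MathematicalPhysics.QuantumLattice
open Literature.Analysis.OperatorTheory.YMMatrixModel

namespace Summit.QuantumFields.YangMills.Theorems.FemtoTransferGap

variable {L : ℕ} [NeZero L]

/-! ### §1. Spans of physical test functions; non-negativity and boundedness of the Rayleigh sets inside a span -/

omit [NeZero L] in
/-- Every element of the real span of a physical family is physical. [folklore] -/
theorem isPhys_of_mem_span {n : ℕ} {φ : Fin n → (GaugeConfig 3 L SU2 → ℝ)} (hφ : ∀ i, IsPhys (φ i))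
    {ψ : GaugeConfig 3 L SU2 → ℝ} (hψ : ψ ∈ Submodule.span ℝ (Set.range φ)) : IsPhys ψ := by
  induction hψ using Submodule.span_induction with
  | mem x hx => obtain ⟨i, rfl⟩ := hx; exact hφ i
  | zero => exact isPhys_const 0
  | add x y _ _ hx hy => exact hx.add hy
  | smul a x _ hx => exact hx.smul a

/-- A Rayleigh quotient of a physical test function is non-negative (`β ≥ 0`) and at most `λ₀`. [cite: ReedSimonIV1978, XIII.1–2] -/
theorem rayleigh_nonneg_and_le {β : ℝ} (hβ : 0 ≤ β) {ψ : GaugeConfig 3 L SU2 → ℝ} (hψ : IsPhys ψ) (hpos : 0 < l2 ψ ψ) :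
    0 ≤ qform su2Rep β ψ ψ / l2 ψ ψ ∧ qform su2Rep β ψ ψ / l2 ψ ψ ≤ levelValue su2Rep L β 0 :=
  ⟨div_nonneg (qform_su2Rep_self_nonneg hβ hψ) hpos.le, rayleigh_le_levelValue_zero su2Rep continuous_su2Rep β hψ hpos⟩

/-- **Ritz values are non-negative** (`β ≥ 0`, physical family): every constrained Rayleigh set inside the span consists of non-negative
numbers, so its `sSup` and the `sInf` of these are `≥ 0` (junk values included). [cite: ReedSimonIV1978, XIII.1–2] -/
theorem ritzValue_nonneg {β : ℝ} (hβ : 0 ≤ β) {n : ℕ} {φ : Fin n → (GaugeConfig 3 L SU2 → ℝ)} (hφ : ∀ i, IsPhys (φ i)) (j : ℕ) :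
    0 ≤ ritzValue β φ j := by
  refine Real.sInf_nonneg ?_
  rintro s ⟨χ, -, rfl⟩
  refine Real.sSup_nonneg ?_
  rintro r ⟨ψ, hψ, -, hpos, rfl⟩
  exact (rayleigh_nonneg_and_le hβ (isPhys_of_mem_span hφ hψ) hpos).1

/-- **The top Ritz value bounds the transfer form on the span**: `0 ≤ ⟨ψ,K_βψ⟩ ≤ m₀ ‖ψ‖²` for `ψ` in the span (`l2` definite there).
[cite: ReedSimonIV1978, XIII.1–2] -/
theorem qform_le_ritzValue_zero_mul {β : ℝ} (hβ : 0 ≤ β) {n : ℕ} {φ : Fin n → (GaugeConfig 3 L SU2 → ℝ)} (hφ : ∀ i, IsPhys (φ i))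
    (hdef : ∀ ψ ∈ Submodule.span ℝ (Set.range φ), ψ ≠ 0 → 0 < l2 ψ ψ)
    {ψ : GaugeConfig 3 L SU2 → ℝ} (hψ : ψ ∈ Submodule.span ℝ (Set.range φ)) :
    0 ≤ qform su2Rep β ψ ψ ∧ qform su2Rep β ψ ψ ≤ ritzValue β φ 0 * l2 ψ ψ := by
  have hphys := isPhys_of_mem_span hφ hψ
  refine ⟨qform_su2Rep_self_nonneg hβ hphys, ?_⟩
  by_cases h0 : ψ = 0
  · subst h0
    have hq : qform su2Rep β (0 : GaugeConfig 3 L SU2 → ℝ) 0 = 0 := by simp [qform]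
    have hl : l2 (0 : GaugeConfig 3 L SU2 → ℝ) 0 = 0 := by simp [l2]
    rw [hq, hl, mul_zero]
  have hpos : 0 < l2 ψ ψ := hdef ψ hψ h0
  rw [← div_le_iff₀ hpos]
  -- `R(ψ) ≤ m₀ = sInf {sSup T_χ : χ : Fin 0 → W}`; each `T_χ` contains `R(ψ)` and is bounded above by `λ₀`
  refine le_csInf ⟨_, fun i => Fin.elim0 i, fun i => Fin.elim0 i, rfl⟩ ?_
  rintro s ⟨χ, -, rfl⟩
  refine le_csSup ⟨levelValue su2Rep L β 0, ?_⟩ ⟨ψ, hψ, fun i => Fin.elim0 i, hpos, rfl⟩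
  rintro r ⟨ψ', hψ', -, hpos', rfl⟩
  exact (rayleigh_nonneg_and_le hβ (isPhys_of_mem_span hφ hψ') hpos').2

/-! ### §2. Riesz representatives of the constraint functionals inside the span; Rayleigh–Ritz ≤ min–max -/

/-- **Riesz representatives inside the span.**  If `l2` is definite on the span `W` of a physical family, then for every physical `g`
there is `χ ∈ W` with `⟨ψ, χ⟩ = ⟨ψ, g⟩` for all `ψ ∈ W` (`l2|_W` is a nondegenerate bilinear form on a finite-dimensional space;
Mathlib `LinearMap.BilinForm.toDual`). [cite: ReedSimonIV1978, XIII.1–2] -/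
theorem exists_mem_span_l2_eq {n : ℕ} {φ : Fin n → (GaugeConfig 3 L SU2 → ℝ)} (hφ : ∀ i, IsPhys (φ i))
    (hdef : ∀ ψ ∈ Submodule.span ℝ (Set.range φ), ψ ≠ 0 → 0 < l2 ψ ψ)
    {g : GaugeConfig 3 L SU2 → ℝ} (hg : IsPhys g) :
    ∃ χ ∈ Submodule.span ℝ (Set.range φ), ∀ ψ ∈ Submodule.span ℝ (Set.range φ), l2 ψ χ = l2 ψ g := by
  set W := Submodule.span ℝ (Set.range φ) with hW
  haveI : FiniteDimensional ℝ W := FiniteDimensional.span_of_finite ℝ (Set.finite_range φ)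
  have hadm : ∀ ψ : W, IsPhys (ψ : GaugeConfig 3 L SU2 → ℝ) := fun ψ => isPhys_of_mem_span hφ ψ.2
  -- `l2` restricted to `W` as a bilinear form
  let B : LinearMap.BilinForm ℝ W := LinearMap.mk₂ ℝ (fun ψ ψ' : W => l2 (ψ : GaugeConfig 3 L SU2 → ℝ) ψ')
    (fun ψ₁ ψ₂ ψ' => by
      simp only [Submodule.coe_add]
      exact l2_add_left (hadm ψ₁) (hadm ψ₂) (hadm ψ'))
    (fun c ψ ψ' => by
      simp only [Submodule.coe_smul, smul_eq_mul]
      exact l2_smul_left c _ _)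
    (fun ψ ψ₁ ψ₂ => by
      simp only [Submodule.coe_add]
      rw [l2_comm, l2_add_left (hadm ψ₁) (hadm ψ₂) (hadm ψ), l2_comm (ψ₁ : GaugeConfig 3 L SU2 → ℝ),
        l2_comm (ψ₂ : GaugeConfig 3 L SU2 → ℝ)])
    (fun c ψ ψ' => by
      simp only [Submodule.coe_smul, smul_eq_mul]
      rw [l2_comm, l2_smul_left, l2_comm])
  have hBapply : ∀ ψ ψ' : W, B ψ ψ' = l2 (ψ : GaugeConfig 3 L SU2 → ℝ) ψ' := fun _ _ => rfl
  -- nondegenerate: `l2 ψ ψ = 0 ⇒ ψ = 0`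
  have hsep : ∀ ψ : W, (∀ ψ' : W, B ψ ψ' = 0) → ψ = 0 := by
    intro ψ h
    by_contra hne
    have hne' : (ψ : GaugeConfig 3 L SU2 → ℝ) ≠ 0 := fun h0 => hne (Subtype.ext h0)
    have hpos := hdef ψ ψ.2 hne'
    have h0 := h ψ
    rw [hBapply] at h0
    exact hpos.ne' h0
  have hB : B.Nondegenerate := by
    refine ⟨hsep, fun ψ h => hsep ψ fun ψ' => ?_⟩
    rw [hBapply, l2_comm, ← hBapply]
    exact h ψ'
  -- the constraint functional `ψ ↦ ⟨ψ, g⟩` and its representative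
  let ℓ : Module.Dual ℝ W :=
    { toFun := fun ψ => l2 (ψ : GaugeConfig 3 L SU2 → ℝ) g
      map_add' := fun ψ₁ ψ₂ => by
        simp only [Submodule.coe_add]
        exact l2_add_left (hadm ψ₁) (hadm ψ₂) hg
      map_smul' := fun c ψ => by
        simp only [Submodule.coe_smul, smul_eq_mul, RingHom.id_apply]
        exact l2_smul_left c _ _ }
  refine ⟨((B.toDual hB).symm ℓ : W), ((B.toDual hB).symm ℓ).2, fun ψ hψ => ?_⟩
  have key := LinearMap.BilinForm.apply_toDual_symm_apply (hB := hB) ℓ ⟨ψ, hψ⟩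
  rw [hBapply] at key
  -- `key : l2 χ ψ = l2 ψ g`
  rw [l2_comm]
  exact key

/-- **Rayleigh–Ritz ≤ min–max**: `ritzValue β φ j ≤ levelValue su2Rep L β j` for a physical family with `l2` definite on its span
(the `χ`-constrained Rayleigh set of the span, `χ` = Riesz representatives of any `j` physical constraints, sits inside the
`φs`-constrained Rayleigh set of all physical test functions). [cite: ReedSimonIV1978, XIII.1–2] -/
theorem ritzValue_le_levelValue {β : ℝ} (hβ : 0 ≤ β) {n : ℕ} {φ : Fin n → (GaugeConfig 3 L SU2 → ℝ)}
    (hφ : ∀ i, IsPhys (φ i)) (hdef : ∀ ψ ∈ Submodule.span ℝ (Set.range φ), ψ ≠ 0 → 0 < l2 ψ ψ) (j : ℕ) :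
    ritzValue β φ j ≤ levelValue su2Rep L β j := by
  unfold levelValue
  refine le_csInf ⟨_, fun _ _ => 1, fun _ => isPhys_const 1, rfl⟩ ?_
  rintro t ⟨φs, hφs, rfl⟩
  -- Riesz representatives of the `j` constraints
  have hrep := fun i => exists_mem_span_l2_eq hφ hdef (hφs i)
  choose χ hχW hχ using hrep
  -- `ritzValue ≤ sSup T_χ`
  have hbdd : BddBelow {s | ∃ χ' : Fin j → (GaugeConfig 3 L SU2 → ℝ), (∀ i, χ' i ∈ Submodule.span ℝ (Set.range φ)) ∧
      s = sSup {r | ∃ ψ ∈ Submodule.span ℝ (Set.range φ), (∀ i, l2 ψ (χ' i) = 0) ∧ 0 < l2 ψ ψ ∧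
        r = qform su2Rep β ψ ψ / l2 ψ ψ}} := by
    refine ⟨0, ?_⟩
    rintro s ⟨χ', -, rfl⟩
    refine Real.sSup_nonneg ?_
    rintro r ⟨ψ, hψ, -, hpos, rfl⟩
    exact (rayleigh_nonneg_and_le hβ (isPhys_of_mem_span hφ hψ) hpos).1
  refine (csInf_le hbdd ⟨χ, hχW, rfl⟩).trans ?_
  -- `sSup T_χ ≤ sSup (rayleighSet φs)`
  refine Real.sSup_le ?_ ?_
  · rintro r ⟨ψ, hψ, horth, hpos, rfl⟩
    refine le_csSup (bddAbove_rayleighSet_su2Rep L β _) ⟨ψ, isPhys_of_mem_span hφ hψ, fun i => ?_, hpos, rfl⟩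
    rw [← hχ i ψ hψ]
    exact horth i
  · refine Real.sSup_nonneg ?_
    rintro r ⟨ψ, hψ, -, hpos, rfl⟩
    exact div_nonneg (qform_su2Rep_self_nonneg hβ hψ) hpos.le

/-! ### §3. The registered stub -/

/-- **`RitzBasics`** — VERBATIM the registered stub `Stmt.stub_ritzBasics` of line «KT» (crux `RunningReduction`), over the tree constants
`ritzValue`∕`qform` : for a physical family `φ : Fin n → _` with `l2` definite on its span and `β ≥ 1`: (1) `m_j ≤ λ_j` for `j < n`;
(2) `0 ≤ ⟨ψ,Kψ⟩ ≤ m₀‖ψ‖²` on the span; (3) `0 ≤ m_j` for `j < n`. [cite: ReedSimonIV1978, XIII.1–2] -/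
theorem ritzBasics :
    ∀ (L : ℕ) [NeZero L] (β : ℝ) (n : ℕ) (φ : Fin n → (GaugeConfig 3 L SU2 → ℝ)), 1 ≤ β →
      (∀ i, IsPhys (φ i)) → (∀ ψ ∈ Submodule.span ℝ (Set.range φ), ψ ≠ 0 → 0 < l2 ψ ψ) →
      (∀ j : ℕ, j < n → ritzValue β φ j ≤ levelValue su2Rep L β j) ∧
      (∀ ψ ∈ Submodule.span ℝ (Set.range φ), 0 ≤ qform su2Rep β ψ ψ ∧ qform su2Rep β ψ ψ ≤ ritzValue β φ 0 * l2 ψ ψ) ∧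
      (∀ j : ℕ, j < n → 0 ≤ ritzValue β φ j) := by
  intro L _ β n φ hβ hφ hdef
  have hβ0 : 0 ≤ β := zero_le_one.trans hβ
  exact ⟨fun j _ => ritzValue_le_levelValue hβ0 hφ hdef j, fun ψ hψ => qform_le_ritzValue_zero_mul hβ0 hφ hdef hψ,
    fun j _ => ritzValue_nonneg hβ0 hφ j⟩

end Summit.QuantumFields.YangMills.Theorems.FemtoTransferGap

end
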